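import Mathlib
import Summits.NavierStokesRegularity.NavierStokesRegularity.Theorems.FilamentSkeletonRssStadiumShiftedContour
import Summits.NavierStokesRegularity.NavierStokesRegularity.Theorems.FilamentSkeletonRssStadiumSourceHolomorphic

/-!
# Height-independence of the plateau-plus-connectors contour, and holomorphy of the continued field (`TangentSkeletonNearStraightL`,
# stmt-NavierStokesRegularity-23320, registered stub `stub_stripPropagation` — the contour-independence step of the own-filament assembly)

The own-filament source contour of the repair census (evidence `DIAG-stripPropagation-ends-g2.md` on 23320, addendum): a PLATEAU `[a, b] + iy`
(`a = c_j − L − 8h`, `b = c_j + L + 8h`, `y = Im z`) joined to the real axis by the TWO FIXED vertical connectors at `a` and `b`.  Relative to the real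
segment the deformed part of the source integral of a kernel `h = K(z, ·)` is
  `Φ(y) = ∫_a^b h(σ + iy) dσ − i•∫_0^y h(b + is) ds + i•∫_0^y h(a + is) ds`.
* `plateau_connectors_eq` : if `h` is holomorphic on an open `U` containing the closed rectangle `[a,b] × [y₀, y₁]` AND the two connector segments
  `{a, b} × ([0,y₀] ∪ [0,y₁])`, then `Φ(y₀) = Φ(y₁)` (Theorems.StadiumShiftedContour.integral_horizontal_eq_shifted + interval additivity).
* `differentiableOn_of_height_family` : a field `U z := R z + Φ_z(Im z)` built from such height-dependent contours is holomorphic on `V` as soon as,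
  near every `z₀ ∈ V`, the heights `Im z` and `Im z₀` are interchangeable and the FIXED-height expression is differentiable at `z₀`
  (Theorems.StadiumSourceHolomorphic.differentiableOn_of_locally_eq).  (No definition is introduced: `Φ` is written out.)
HONEST FRAMING: a tool for a HYPOTHETICAL filament skeleton on the NEGATIVE side of a MODEL route; nothing here bears on Navier–Stokes regularity
or blow-up.  `--supports stmt-NavierStokesRegularity-23320`.
-/

set_option linter.dupNamespace false

noncomputable section

namespace Summit.NavierStokesRegularity.NavierStokesRegularity.Theorems.StadiumContourFamily

open Set MeasureTheory Complex Filter Topology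
open Summit.NavierStokesRegularity.NavierStokesRegularity.Theorems.StadiumShiftedContour
open Summit.NavierStokesRegularity.NavierStokesRegularity.Theorems.StadiumSourceHolomorphic

variable {G : Type*} [NormedAddCommGroup G] [NormedSpace ℂ G]

/-- **Height independence.**  See the module docstring. [folklore] -/
theorem plateau_connectors_eq {U : Set ℂ} {h : ℂ → G} (hh : DifferentiableOn ℂ h U) {a b y₀ y₁ : ℝ}
    (hrect : (Set.uIcc a b ×ℂ Set.uIcc y₀ y₁) ⊆ U)
    (hconn_a : ∀ s ∈ Set.uIcc 0 y₀ ∪ Set.uIcc 0 y₁, (a : ℂ) + (s : ℂ) * I ∈ U)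
    (hconn_b : ∀ s ∈ Set.uIcc 0 y₀ ∪ Set.uIcc 0 y₁, (b : ℂ) + (s : ℂ) * I ∈ U) :
    (∫ σ in a..b, h ((σ : ℂ) + (y₀ : ℂ) * I)) - I • (∫ s in (0:ℝ)..y₀, h ((b : ℂ) + (s : ℂ) * I))
        + I • (∫ s in (0:ℝ)..y₀, h ((a : ℂ) + (s : ℂ) * I)) =
      (∫ σ in a..b, h ((σ : ℂ) + (y₁ : ℂ) * I)) - I • (∫ s in (0:ℝ)..y₁, h ((b : ℂ) + (s : ℂ) * I))
        + I • (∫ s in (0:ℝ)..y₁, h ((a : ℂ) + (s : ℂ) * I)) := by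
  have hcont : ContinuousOn h U := hh.continuousOn
  have hpath : ∀ x : ℝ, Continuous fun s : ℝ => (x : ℂ) + (s : ℂ) * I := fun x =>
    continuous_const.add (Complex.continuous_ofReal.mul continuous_const)
  -- integrability of the connector integrands on the three intervals
  have hint : ∀ (x : ℝ), (∀ s ∈ Set.uIcc 0 y₀ ∪ Set.uIcc 0 y₁, (x : ℂ) + (s : ℂ) * I ∈ U) →
      ∀ p q : ℝ, Set.uIcc p q ⊆ Set.uIcc 0 y₀ ∪ Set.uIcc 0 y₁ →
        IntervalIntegrable (fun s : ℝ => h ((x : ℂ) + (s : ℂ) * I)) volume p q := by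
    intro x hx p q hpq
    refine (ContinuousOn.intervalIntegrable ?_)
    exact hcont.comp (hpath x).continuousOn fun s hs => hx s (hpq hs)
  have hsub0 : Set.uIcc 0 y₀ ⊆ Set.uIcc 0 y₀ ∪ Set.uIcc 0 y₁ := subset_union_left
  have hsub1 : Set.uIcc 0 y₁ ⊆ Set.uIcc 0 y₀ ∪ Set.uIcc 0 y₁ := subset_union_right
  have hsub01 : Set.uIcc y₀ y₁ ⊆ Set.uIcc 0 y₀ ∪ Set.uIcc 0 y₁ := by
    have h := (Set.uIcc_subset_uIcc_union_uIcc : Set.uIcc y₀ y₁ ⊆ Set.uIcc y₀ 0 ∪ Set.uIcc 0 y₁)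
    rwa [Set.uIcc_comm y₀ 0] at h
  have ha0 := hint a hconn_a 0 y₀ hsub0
  have ha01 := hint a hconn_a y₀ y₁ hsub01
  have hb0 := hint b hconn_b 0 y₀ hsub0
  have hb01 := hint b hconn_b y₀ y₁ hsub01
  -- split the connectors at `y₀`
  have hsa : ∫ s in (0:ℝ)..y₁, h ((a : ℂ) + (s : ℂ) * I) =
      (∫ s in (0:ℝ)..y₀, h ((a : ℂ) + (s : ℂ) * I)) + ∫ s in y₀..y₁, h ((a : ℂ) + (s : ℂ) * I) :=
    (intervalIntegral.integral_add_adjacent_intervals ha0 ha01).symm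
  have hsb : ∫ s in (0:ℝ)..y₁, h ((b : ℂ) + (s : ℂ) * I) =
      (∫ s in (0:ℝ)..y₀, h ((b : ℂ) + (s : ℂ) * I)) + ∫ s in y₀..y₁, h ((b : ℂ) + (s : ℂ) * I) :=
    (intervalIntegral.integral_add_adjacent_intervals hb0 hb01).symm
  -- Cauchy on the rectangle
  have H := integral_horizontal_eq_shifted hh hrect
  rw [H, hsa, hsb, smul_add, smul_add]
  abel

/-- **Holomorphy of a field defined through height-dependent contours.**  `U z = R z + Φ (Im z) z` where `Φ y z` is the deformed contour
expression at height `y`; if near each `z₀ ∈ V` the height can be frozen at `Im z₀` (`Φ (Im z) z = Φ (Im z₀) z` on a neighbourhood) and the frozen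
expression `z ↦ R z + Φ (Im z₀) z` is differentiable at `z₀`, then `U` is holomorphic on `V`. [folklore] -/
theorem differentiableOn_of_height_family {E : Type*} [NormedAddCommGroup E] [NormedSpace ℂ E] {V : Set ℂ}
    {R : ℂ → E} {Φ : ℝ → ℂ → E}
    (hfreeze : ∀ z₀ ∈ V, ∃ N ∈ 𝓝 z₀, ∀ z ∈ N, Φ z.im z = Φ z₀.im z)
    (hdiff : ∀ z₀ ∈ V, DifferentiableAt ℂ (fun z => R z + Φ z₀.im z) z₀) :
    DifferentiableOn ℂ (fun z => R z + Φ z.im z) V := by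
  refine differentiableOn_of_locally_eq fun z₀ hz₀ => ?_
  obtain ⟨N, hN, hfr⟩ := hfreeze z₀ hz₀
  exact ⟨N, hN, fun z => R z + Φ z₀.im z, hdiff z₀ hz₀, fun z hz => by simp only [hfr z hz]⟩

end Summit.NavierStokesRegularity.NavierStokesRegularity.Theorems.StadiumContourFamily

end
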